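import Literature.Analysis.FluidPDE.BackwardUniquenessCutoff
import HarnessLib

/-!
# Crux `ExtremiserTransience.NearExtremalTransience` (stmt-NavierStokesRegularity-21883), line `extremiser_liouville`,
# stub K1b — THE ADMISSIBLE LAYER WEIGHT `g_{a,L}(s) = H((s − a)/L)` OF (INEQ)₃ (R6b input, record §3/§15/§18)

`--supports stmt-NavierStokesRegularity-21883` (helper).  Author: prover seat `ns-el-k1b` (g9).

`slideInequality_layer` (`…ConstantSpeedSlideInequalityLayer`) is stated for a slide profile `g ∈ C^∞(ℝ)` with `g ≥ 0`, `g′ ≥ 0`,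
`g, g′, g″, g‴` bounded and `g′ = g″ = g‴ = 0` on `{|s| ≥ T}`.  The absorption ledger R6b uses the one-parameter family of smooth
steps `g_{a,L}(s) = H((s − a)/L)` (`H` = Mathlib's `Real.smoothTransition`), whose derivative `γ_{a,L} = g′_{a,L} = L⁻¹H′((s−a)/L) ≥ 0`
is the LAYER WEIGHT supported in `[a, a + L]`, with `|g⁽ᵏ⁾| ≤ D_k/Lᵏ` for absolute constants `D_k` (`k ≤ 3`).  This file discharges
all the profile hypotheses of (INEQ)₃ for this family (the second-derivative facts are the tree's
`Literature…Carleman.deriv_deriv_smoothTransition_of_neg/…_of_one_lt/exists_bound_…`; the third derivative is added here;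
`H′ ∈ C^∞` is also `Literature.Analysis.PDE.contDiff_deriv_smoothTransition'`, re-derived inline to keep the imports light).
* `deriv3_smoothTransition_of_neg`, `deriv3_smoothTransition_of_one_lt`, `exists_bound_deriv3_smoothTransition` : `H‴` off `[0,1]` and its bound;
* `hasDerivAt_comp_layerAffine` : chain rule for `F((s−a)/L)`;
* `deriv_layerStep`, `deriv2_layerStep`, `deriv3_layerStep` : `g′, g″, g‴` of `g_{a,L}` in closed form;
* `contDiff_layerStep`, `layerStep_nonneg`, `abs_layerStep_le_one`, `deriv_layerStep_nonneg` : `C^∞`, `0 ≤ g ≤ 1`, `g′ ≥ 0`;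
* `derivs_layerStep_eq_zero` : `g′ = g″ = g‴ = 0` for `s < a` or `a + L < s` (hence on `{|s| ≥ T}` once `a + L < T`, `−T < a`:
  `derivs_layerStep_eq_zero_of_le_abs`);
* `exists_bounds_derivs_layerStep` : absolute `D₁, D₂, D₃` with `|g′| ≤ D₁/L`, `|g″| ≤ D₂/L²`, `|g‴| ≤ D₃/L³`.

WHAT THIS IS NOT: K1b is NOT proved; nothing here proves NS regularity. [folklore]
-/

noncomputable section

open Set Filter Topology
open Literature.Analysis Literature.Analysis.FluidPDE

namespace Summit.NavierStokesRegularity.NavierStokesRegularity.Theorems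

-- the problem directory repeats the summit name (`NavierStokesRegularity/NavierStokesRegularity`)
set_option linter.dupNamespace false

namespace ExtremiserLiouville

/-! ## 1. The third derivative of the smooth transition -/

/-- `H″` is `C^∞`. [folklore] -/
theorem contDiff_deriv_deriv_smoothTransition : ContDiff ℝ (⊤ : ℕ∞) (deriv (deriv Real.smoothTransition)) := by
  simpa using (Real.smoothTransition.contDiff (n := ⊤)).iterate_deriv 2

/-- `H‴ = 0` on `(−∞, 0)`. [folklore] -/
theorem deriv3_smoothTransition_of_neg {t : ℝ} (ht : t < 0) : deriv (deriv (deriv Real.smoothTransition)) t = 0 := by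
  have hev : deriv (deriv Real.smoothTransition) =ᶠ[𝓝 t] fun _ => 0 := by
    filter_upwards [(isOpen_lt continuous_id continuous_const).mem_nhds ht] with s hs
    exact Carleman.deriv_deriv_smoothTransition_of_neg hs
  rw [hev.deriv_eq]
  simp

/-- `H‴ = 0` on `(1, ∞)`. [folklore] -/
theorem deriv3_smoothTransition_of_one_lt {t : ℝ} (ht : 1 < t) : deriv (deriv (deriv Real.smoothTransition)) t = 0 := by
  have hev : deriv (deriv Real.smoothTransition) =ᶠ[𝓝 t] fun _ => 0 := by
    filter_upwards [(isOpen_lt continuous_const continuous_id).mem_nhds ht] with s hs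
    exact Carleman.deriv_deriv_smoothTransition_of_one_lt hs
  rw [hev.deriv_eq]
  simp

/-- `H‴` is bounded on `ℝ`. [folklore] -/
theorem exists_bound_deriv3_smoothTransition : ∃ D : ℝ, 0 ≤ D ∧ ∀ t, |deriv (deriv (deriv Real.smoothTransition)) t| ≤ D := by
  have hc : Continuous (deriv (deriv (deriv Real.smoothTransition))) := contDiff_deriv_deriv_smoothTransition.continuous_deriv (by simp)
  obtain ⟨C, hC⟩ := isCompact_Icc.exists_bound_of_continuousOn (hc.continuousOn (s := Icc 0 1))
  refine ⟨max C 0, le_max_right _ _, fun t => ?_⟩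
  rcases lt_or_ge t 0 with h0 | h0
  · rw [deriv3_smoothTransition_of_neg h0, abs_zero]; exact le_max_right _ _
  rcases lt_or_ge 1 t with h1 | h1
  · rw [deriv3_smoothTransition_of_one_lt h1, abs_zero]; exact le_max_right _ _
  exact ((Real.norm_eq_abs _).symm.le.trans (hC t ⟨h0, h1⟩)).trans (le_max_left _ _)

/-! ## 2. The layer step `g_{a,L}(s) = H((s − a)/L)` and its derivatives -/

variable {a L : ℝ}

/-- Chain rule along the affine map `s ↦ (s − a)/L`. [folklore] -/
theorem hasDerivAt_comp_layerAffine {F : ℝ → ℝ} {F' : ℝ} {s : ℝ} (hF : HasDerivAt F F' ((s - a) / L)) :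
    HasDerivAt (fun s : ℝ => F ((s - a) / L)) (F' / L) s := by
  have hA : HasDerivAt (fun s : ℝ => (s - a) / L) (1 / L) s := by
    simpa using ((hasDerivAt_id s).sub_const a).div_const L
  have h := hF.comp s hA
  have e : F' * (1 / L) = F' / L := by ring
  rw [e] at h
  exact h

/-- **`g′_{a,L}(s) = H′((s−a)/L)/L`.** [folklore] -/
theorem deriv_layerStep : deriv (fun s : ℝ => Real.smoothTransition ((s - a) / L)) = fun s => deriv Real.smoothTransition ((s - a) / L) / L :=
  funext fun _ => (hasDerivAt_comp_layerAffine ((Calculus.differentiable_smoothTransition _).hasDerivAt)).deriv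

/-- **`g″_{a,L}(s) = H″((s−a)/L)/L²`.** [folklore] -/
theorem deriv2_layerStep : deriv (deriv (fun s : ℝ => Real.smoothTransition ((s - a) / L))) = fun s => deriv (deriv Real.smoothTransition) ((s - a) / L) / L ^ 2 := by
  rw [deriv_layerStep]
  funext s
  have hd : ContDiff ℝ (⊤ : ℕ∞) (deriv Real.smoothTransition) := by
    simpa using (Real.smoothTransition.contDiff (n := ⊤)).iterate_deriv 1
  have h1 : HasDerivAt (fun s : ℝ => deriv Real.smoothTransition ((s - a) / L)) (deriv (deriv Real.smoothTransition) ((s - a) / L) / L) s :=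
    hasDerivAt_comp_layerAffine ((hd.differentiable (by simp)) _).hasDerivAt
  rw [(h1.div_const L).deriv]
  ring

/-- **`g‴_{a,L}(s) = H‴((s−a)/L)/L³`.** [folklore] -/
theorem deriv3_layerStep : deriv (deriv (deriv (fun s : ℝ => Real.smoothTransition ((s - a) / L)))) = fun s => deriv (deriv (deriv Real.smoothTransition)) ((s - a) / L) / L ^ 3 := by
  rw [deriv2_layerStep]
  funext s
  have h1 : HasDerivAt (fun s : ℝ => deriv (deriv Real.smoothTransition) ((s - a) / L)) (deriv (deriv (deriv Real.smoothTransition)) ((s - a) / L) / L) s :=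
    hasDerivAt_comp_layerAffine ((contDiff_deriv_deriv_smoothTransition.differentiable (by simp)) _).hasDerivAt
  rw [(h1.div_const (L ^ 2)).deriv]
  ring

/-- `g_{a,L} ∈ C^∞`. [folklore] -/
theorem contDiff_layerStep : ContDiff ℝ (⊤ : ℕ∞) (fun s : ℝ => Real.smoothTransition ((s - a) / L)) :=
  Real.smoothTransition.contDiff.comp ((contDiff_id.sub contDiff_const).div_const _)

/-- `0 ≤ g_{a,L}`. [folklore] -/
theorem layerStep_nonneg (s : ℝ) : 0 ≤ (fun s : ℝ => Real.smoothTransition ((s - a) / L)) s := Real.smoothTransition.nonneg _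

/-- `|g_{a,L}| ≤ 1`. [folklore] -/
theorem abs_layerStep_le_one (s : ℝ) : |(fun s : ℝ => Real.smoothTransition ((s - a) / L)) s| ≤ 1 := by
  rw [abs_of_nonneg (Real.smoothTransition.nonneg _)]
  exact Real.smoothTransition.le_one _

/-- **`g′_{a,L} ≥ 0`** for `L > 0` (the layer weight `γ_{a,L} = g′_{a,L}` is non-negative). [folklore] -/
theorem deriv_layerStep_nonneg (hL : 0 < L) (s : ℝ) : 0 ≤ deriv (fun s : ℝ => Real.smoothTransition ((s - a) / L)) s := by
  rw [deriv_layerStep]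
  exact div_nonneg Real.smoothTransition.monotone.deriv_nonneg hL.le

/-- **`g′ = g″ = g‴ = 0` off `[a, a + L]`** (`L > 0`). [folklore] -/
theorem derivs_layerStep_eq_zero (hL : 0 < L) {s : ℝ} (hs : s < a ∨ a + L < s) :
    deriv (fun s : ℝ => Real.smoothTransition ((s - a) / L)) s = 0 ∧ deriv (deriv (fun s : ℝ => Real.smoothTransition ((s - a) / L))) s = 0 ∧ deriv (deriv (deriv (fun s : ℝ => Real.smoothTransition ((s - a) / L)))) s = 0 := by
  rw [deriv3_layerStep, deriv2_layerStep, deriv_layerStep]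
  rcases hs with hs | hs
  · have ht : (s - a) / L < 0 := div_neg_of_neg_of_pos (by linarith) hL
    simp [Calculus.deriv_smoothTransition_of_nonpos ht.le, Carleman.deriv_deriv_smoothTransition_of_neg ht,
      deriv3_smoothTransition_of_neg ht]
  · have ht : 1 < (s - a) / L := by rw [lt_div_iff₀ hL]; linarith
    simp [Calculus.deriv_smoothTransition_of_one_le ht.le, Carleman.deriv_deriv_smoothTransition_of_one_lt ht,
      deriv3_smoothTransition_of_one_lt ht]

/-- The (INEQ)₃ form of the support condition: if `−T < a` and `a + L < T` then `g′ = g″ = g‴ = 0` on `{|s| ≥ T}`. [folklore] -/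
theorem derivs_layerStep_eq_zero_of_le_abs (hL : 0 < L) {T : ℝ} (h1 : -T < a) (h2 : a + L < T) {s : ℝ} (hs : T ≤ |s|) :
    deriv (fun s : ℝ => Real.smoothTransition ((s - a) / L)) s = 0 ∧ deriv (deriv (fun s : ℝ => Real.smoothTransition ((s - a) / L))) s = 0 ∧ deriv (deriv (deriv (fun s : ℝ => Real.smoothTransition ((s - a) / L)))) s = 0 := by
  refine derivs_layerStep_eq_zero hL ?_
  rcases le_abs.1 hs with h | h
  · exact Or.inr (by linarith)
  · exact Or.inl (by linarith)

/-- **Scale-invariant derivative bounds**: absolute constants `D₁, D₂, D₃ ≥ 0` with `|g′_{a,L}| ≤ D₁/L`, `|g″_{a,L}| ≤ D₂/L²`,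
`|g‴_{a,L}| ≤ D₃/L³` for all `a` and all `L > 0`. [folklore] -/
theorem exists_bounds_derivs_layerStep : ∃ D₁ D₂ D₃ : ℝ, 0 ≤ D₁ ∧ 0 ≤ D₂ ∧ 0 ≤ D₃ ∧ ∀ a L : ℝ, 0 < L → ∀ s : ℝ,
    |deriv (fun s : ℝ => Real.smoothTransition ((s - a) / L)) s| ≤ D₁ / L ∧ |deriv (deriv (fun s : ℝ => Real.smoothTransition ((s - a) / L))) s| ≤ D₂ / L ^ 2 ∧ |deriv (deriv (deriv (fun s : ℝ => Real.smoothTransition ((s - a) / L)))) s| ≤ D₃ / L ^ 3 := by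
  obtain ⟨D₁, hD₁, hb₁⟩ := Calculus.exists_bound_deriv_smoothTransition
  obtain ⟨D₂, hD₂, hb₂⟩ := Carleman.exists_bound_deriv_deriv_smoothTransition
  obtain ⟨D₃, hD₃, hb₃⟩ := exists_bound_deriv3_smoothTransition
  refine ⟨D₁, D₂, D₃, hD₁, hD₂, hD₃, fun a L hL s => ?_⟩
  rw [deriv3_layerStep, deriv2_layerStep, deriv_layerStep]
  simp only [abs_div, abs_of_pos hL, abs_of_pos (pow_pos hL 2), abs_of_pos (pow_pos hL 3)]
  exact ⟨div_le_div_of_nonneg_right (hb₁ _) hL.le, div_le_div_of_nonneg_right (hb₂ _) (pow_pos hL 2).le,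
    div_le_div_of_nonneg_right (hb₃ _) (pow_pos hL 3).le⟩

end ExtremiserLiouville

end Summit.NavierStokesRegularity.NavierStokesRegularity.Theorems

end
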